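import Mathlib
import Literature.NumberTheory.LFunctions.RiemannXiProofs
import Literature.NumberTheory.LFunctions.ZetaRealAxis
import Literature.NumberTheory.LFunctions.ZetaZerosProofs
import Summits.RiemannHypothesis.RiemannHypothesis.Theorems.SoloInformedGroundStateLimit
import HarnessLib

/-!
# The zero-counting function of `Ξ` with multiplicity, and `N(T) = zetaZeroCount T`

Handoff track (ROUTE 1′), prove-1 gen13; support file for `HandoffCountThin.lean` (idea-3 gen22
ROUTE R-K «COUNT-AND-THIN», TASK H-K1; HOME/handoff/IDEAS-finite-rank.md v3.3.1 §G22-3/§G22-4).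

* Facts about `Ξ = riemannXiUpper` (`Ξ(z) = ξ(1/2 + iz)`; entire and `≢ 0` are the tree's
  `differentiable_riemannXiUpper'`, `not_eqOn_zero_riemannXiUpper` of `SoloInformedGroundStateLimit`):
  of finite analytic order at every point, no zeros on the imaginary axis (`ζ ≠ 0` on the real segment `(0, 1)`,
  `riemannZeta_ne_zero_of_im_eq_zero_of_pos_of_lt_one`), the non-vanishing of the derivative of
  order `analyticOrderNatAt Ξ z` (Mathlib's `natCast_le_analyticOrderAt_iff_iteratedDeriv_eq_zero`).
* `xiZeros_finite T`: the zeros `z` of `Ξ` with `0 < Re z ≤ T` form a finite set.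
* THE BRIDGE `sum_analyticOrderNatAt_eq_zetaZeroCount`:
  `Σ_{Ξ z = 0, 0 < Re z ≤ T} analyticOrderNatAt Ξ z = zetaZeroCount T` — under
  `z ↦ ρ = 1/2 + iz` the box is `zetaZeroBox 0 T` and the analytic order of `Ξ` at `z` is the
  multiplicity `riemannZetaZeroOrder ρ` of `ζ` at `ρ` (`ξ = ½ s(s-1)·Γ_ℝ·ζ` with a non-vanishing
  analytic cofactor in the strip). So the `Ξ`-side count IS the tree's Riemann–von Mangoldt `N(T)`
  (`Literature.NumberTheory.LFunctions.zetaZeroCount`, zeros with `0 < Im ρ ≤ T` counted with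
  multiplicity). RH-free bookkeeping; nothing here bears on the truth of RH.
-/

set_option linter.dupNamespace false  -- the mandated namespace repeats `RiemannHypothesis`

noncomputable section

open Filter Set Topology Complex
open scoped BigOperators
open Literature.NumberTheory.LFunctions

namespace Summit.RiemannHypothesis.RiemannHypothesis.Theorems

namespace CountThin

/-! ## Facts about `Ξ` -/

/-- `Ξ` is analytic at every point. -/
theorem analyticAt_riemannXiUpper (z : ℂ) : AnalyticAt ℂ riemannXiUpper z :=
  differentiable_riemannXiUpper'.analyticAt z

/-- `Ξ` vanishes identically near no point: its analytic order is finite everywhere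
(`not_eqOn_zero_riemannXiUpper` of `SoloInformedGroundStateLimit`). -/
theorem analyticOrderAt_riemannXiUpper_ne_top (z : ℂ) : analyticOrderAt riemannXiUpper z ≠ ⊤ := by
  intro h
  rw [analyticOrderAt_eq_top] at h
  obtain ⟨U, hU, hUo, hzU⟩ := eventually_nhds_iff.mp h
  exact not_eqOn_zero_riemannXiUpper hUo hzU fun w hw => hU w hw

/-- A zero `z` of `Ξ` gives the non-trivial zero `1/2 + iz` of `ζ`. -/
theorem zeta_zero_of_riemannXiUpper_eq_zero {z : ℂ} (hz : riemannXiUpper z = 0) :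
    riemannZeta (1 / 2 + I * z) = 0 ∧ 0 < (1 / 2 + I * z).re ∧ (1 / 2 + I * z).re < 1 :=
  (riemannXi_eq_zero_iff_holds _).mp hz

/-- `Re(1/2 + iz) = 1/2 - Im z`. -/
theorem re_half_add_I_mul (z : ℂ) : (1 / 2 + I * z).re = 1 / 2 - z.im := by
  simp [Complex.add_re, Complex.mul_re]; ring

/-- `Im(1/2 + iz) = Re z`. -/
theorem im_half_add_I_mul (z : ℂ) : (1 / 2 + I * z).im = z.re := by
  simp [Complex.add_im, Complex.mul_im]

/-- `Ξ` has no zeros on the imaginary axis (`ζ(σ) ≠ 0` for real `σ ∈ (0, 1)`, and `ξ` has no zeros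
outside the critical strip). -/
theorem re_ne_zero_of_riemannXiUpper_eq_zero {z : ℂ} (hz : riemannXiUpper z = 0) : z.re ≠ 0 := by
  intro hre
  obtain ⟨hζ, h0, h1⟩ := zeta_zero_of_riemannXiUpper_eq_zero hz
  exact riemannZeta_ne_zero_of_im_eq_zero_of_pos_of_lt_one (by rw [im_half_add_I_mul, hre]) h0 h1 hζ

/-- A zero of `Ξ` has positive (finite) order. -/
theorem one_le_analyticOrderNatAt_of_zero {z : ℂ} (hz : riemannXiUpper z = 0) :
    1 ≤ analyticOrderNatAt riemannXiUpper z := by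
  have hne : analyticOrderAt riemannXiUpper z ≠ 0 :=
    analyticOrderAt_ne_zero.mpr ⟨analyticAt_riemannXiUpper z, hz⟩
  have htop := analyticOrderAt_riemannXiUpper_ne_top z
  have : (analyticOrderNatAt riemannXiUpper z : ℕ∞) ≠ 0 := by
    rwa [Nat.cast_analyticOrderNatAt htop]
  exact Nat.one_le_iff_ne_zero.mpr (by exact_mod_cast this)

/-- At every point, the derivative of `Ξ` of order `analyticOrderNatAt Ξ z` does not vanish. -/
theorem iteratedDeriv_analyticOrderNatAt_ne_zero (z : ℂ) :
    iteratedDeriv (analyticOrderNatAt riemannXiUpper z) riemannXiUpper z ≠ 0 := by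
  set n := analyticOrderNatAt riemannXiUpper z with hn
  have htop := analyticOrderAt_riemannXiUpper_ne_top z
  have hcast : (n : ℕ∞) = analyticOrderAt riemannXiUpper z := Nat.cast_analyticOrderNatAt htop
  have hlow : ∀ i < n, iteratedDeriv i riemannXiUpper z = 0 :=
    (natCast_le_analyticOrderAt_iff_iteratedDeriv_eq_zero (analyticAt_riemannXiUpper z)).mp hcast.le
  have hnot : ¬ ((n + 1 : ℕ) : ℕ∞) ≤ analyticOrderAt riemannXiUpper z := by
    rw [← hcast]; exact_mod_cast Nat.lt_irrefl n
  rw [natCast_le_analyticOrderAt_iff_iteratedDeriv_eq_zero (analyticAt_riemannXiUpper z)] at hnot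
  push Not at hnot
  obtain ⟨i, hi, hne⟩ := hnot
  have : i = n := by
    by_contra h
    exact hne (hlow i (by omega))
  rwa [this] at hne

/-! ## The counting function of `Ξ` -/

/-- `z ↦ 1/2 + iz` maps the zeros of `Ξ` with `0 < Re z ≤ T` into `zetaZeroBox 0 T`. -/
theorem half_add_I_mul_mem_zetaZeroBox {T : ℝ} {z : ℂ}
    (hz : z ∈ {z : ℂ | riemannXiUpper z = 0 ∧ 0 < z.re ∧ z.re ≤ T}) :
    1 / 2 + I * z ∈ zetaZeroBox 0 T := by
  obtain ⟨hz, h0, hT⟩ := hz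
  obtain ⟨hζ, hre0, hre1⟩ := zeta_zero_of_riemannXiUpper_eq_zero hz
  exact ⟨hζ, hre0.le, hre1.le, by rw [im_half_add_I_mul]; exact h0, by rw [im_half_add_I_mul]; exact hT⟩

/-- The zeros of `Ξ` with `0 < Re z ≤ T` (equivalently the zeros `ρ = 1/2 + iz` of `ζ` with
`0 < Im ρ ≤ T`) form a finite set: they inject into `zetaZeroBox 0 T`. -/
theorem xiZeros_finite (T : ℝ) : {z : ℂ | riemannXiUpper z = 0 ∧ 0 < z.re ∧ z.re ≤ T}.Finite := by
  have hinj : Set.InjOn (fun z : ℂ => 1 / 2 + I * z) {z : ℂ | riemannXiUpper z = 0 ∧ 0 < z.re ∧ z.re ≤ T} := by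
    intro z _ w _ h
    have : I * z = I * w := by simpa using h
    exact mul_left_cancel₀ I_ne_zero this
  refine Set.Finite.of_finite_image ((zetaZeroBox_finite 0 T).subset ?_) hinj
  rintro _ ⟨z, hz, rfl⟩
  exact half_add_I_mul_mem_zetaZeroBox hz

/-! ## The bridge to `zetaZeroCount` -/

/-- Analytic order is invariant under an affine change of variable `w ↦ a + b w` (`b ≠ 0`):
if `f` has finite order `n` at `a + b z₀`, then `f ∘ (a + b ·)` has order `n` at `z₀`. [folklore] -/
theorem analyticOrderAt_comp_affine {f : ℂ → ℂ} {a b z₀ : ℂ} (hb : b ≠ 0) {n : ℕ}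
    (hf : AnalyticAt ℂ f (a + b * z₀)) (hn : analyticOrderAt f (a + b * z₀) = n) :
    analyticOrderAt (fun w => f (a + b * w)) z₀ = n := by
  obtain ⟨g, hg, hg0, hfg⟩ := (hf.analyticOrderAt_eq_natCast).mp hn
  have hA : AnalyticAt ℂ (fun w : ℂ => a + b * w) z₀ := by fun_prop
  have hcont : Tendsto (fun w : ℂ => a + b * w) (𝓝 z₀) (𝓝 (a + b * z₀)) :=
    hA.continuousAt.tendsto
  have hfA : AnalyticAt ℂ (fun w => f (a + b * w)) z₀ := hf.comp_of_eq hA rfl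
  have hgA : AnalyticAt ℂ (fun w => g (a + b * w)) z₀ := hg.comp_of_eq hA rfl
  refine (hfA.analyticOrderAt_eq_natCast).mpr ⟨fun w => b ^ n * g (a + b * w), ?_, ?_, ?_⟩
  · exact analyticAt_const.mul hgA
  · exact mul_ne_zero (pow_ne_zero n hb) hg0
  · filter_upwards [hcont.eventually hfg] with w hw
    rw [hw, smul_eq_mul, smul_eq_mul, show a + b * w - (a + b * z₀) = b * (w - z₀) by ring, mul_pow]
    ring

/-- In the critical strip, `ξ` and `ζ` vanish to the same order: near `ρ` (`0 < Re ρ < 1`),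
`ζ(s) = ξ(s) · [2/(s(s-1)) · Γ_ℝ(s)⁻¹]` with an analytic non-vanishing cofactor. [folklore] -/
theorem analyticOrderAt_riemannZeta_eq_riemannXi {ρ : ℂ} (h0 : 0 < ρ.re) (h1 : ρ.re < 1) :
    analyticOrderAt riemannZeta ρ = analyticOrderAt riemannXi ρ := by
  have hρ0 : ρ ≠ 0 := fun h => by simp [h] at h0
  have hρ1 : ρ ≠ 1 := fun h => by simp [h] at h1
  -- the cofactor
  set u : ℂ → ℂ := fun s => 2 / (s * (s - 1)) * (Gammaℝ s)⁻¹ with hu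
  have hu_an : AnalyticAt ℂ u ρ := by
    have h2 : AnalyticAt ℂ (fun s : ℂ => 2 / (s * (s - 1))) ρ := by
      apply AnalyticAt.div analyticAt_const (by fun_prop)
      exact mul_ne_zero hρ0 (sub_ne_zero.mpr hρ1)
    exact h2.mul (differentiable_Gammaℝ_inv.analyticAt ρ)
  have hu_ne : u ρ ≠ 0 := by
    simp only [u]
    refine mul_ne_zero (div_ne_zero two_ne_zero (mul_ne_zero hρ0 (sub_ne_zero.mpr hρ1))) ?_
    exact inv_ne_zero (Gammaℝ_ne_zero_of_re_pos h0)
  -- `ζ = ξ · u` near `ρ`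
  have hU : ∀ᶠ s in 𝓝 ρ, s ≠ 0 ∧ s ≠ 1 :=
    (isOpen_ne.inter isOpen_ne).mem_nhds ⟨hρ0, hρ1⟩
  have heq : (riemannXi * u) =ᶠ[𝓝 ρ] riemannZeta := by
    filter_upwards [hU] with s hs
    have hss : s * (s - 1) ≠ 0 := mul_ne_zero hs.1 (sub_ne_zero.mpr hs.2)
    have hc : s * (s - 1) / 2 * (2 / (s * (s - 1))) = 1 := by
      rw [div_mul_div_comm, mul_comm (s * (s - 1)) 2, div_self (mul_ne_zero two_ne_zero hss)]
    calc (riemannXi * u) s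
        = (s * (s - 1) / 2 * (2 / (s * (s - 1)))) * (completedRiemannZeta s * (Gammaℝ s)⁻¹) := by
          rw [Pi.mul_apply, riemannXi_eq_mul_completedRiemannZeta hs.1 hs.2]; simp only [u]; ring
      _ = riemannZeta s := by rw [hc, one_mul, riemannZeta_def_of_ne_zero hs.1, div_eq_mul_inv]
  rw [← analyticOrderAt_congr heq,
    analyticOrderAt_mul ((differentiable_riemannXi).analyticAt ρ) hu_an,
    (hu_an.analyticOrderAt_eq_zero).mpr hu_ne, add_zero]

/-- The analytic order of `Ξ` at `z` is the multiplicity `m(1/2 + iz)` of `ζ` whenever `1/2 + iz`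
lies in the critical strip. -/
theorem analyticOrderNatAt_riemannXiUpper_eq {z : ℂ} (h0 : 0 < (1 / 2 + I * z).re)
    (h1 : (1 / 2 + I * z).re < 1) :
    (analyticOrderNatAt riemannXiUpper z : ℤ) = riemannZetaZeroOrder (1 / 2 + I * z) := by
  set ρ := 1 / 2 + I * z with hρ
  have hρ1 : ρ ≠ 1 := fun h => by rw [h] at h1; simp at h1
  have htop := analyticOrderAt_riemannXiUpper_ne_top z
  set n := analyticOrderNatAt riemannXiUpper z with hn
  have hΞ : analyticOrderAt riemannXiUpper z = n := (Nat.cast_analyticOrderNatAt htop).symm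
  -- order of `ξ` at `ρ` is `n` (affine change of variable), hence so is the order of `ζ`
  have hξan : AnalyticAt ℂ riemannXi ρ := (differentiable_riemannXi).analyticAt ρ
  have hξtop : analyticOrderAt riemannXi ρ ≠ ⊤ := by
    intro htop'
    obtain ⟨m, hm⟩ := ENat.ne_top_iff_exists.mp htop
    -- if `ξ` vanished identically near `ρ`, so would `Ξ` near `z`
    rw [analyticOrderAt_eq_top] at htop'
    have hcont : Tendsto (fun w : ℂ => 1 / 2 + I * w) (𝓝 z) (𝓝 ρ) := by
      have : ContinuousAt (fun w : ℂ => 1 / 2 + I * w) z := by fun_prop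
      exact this.tendsto
    have : analyticOrderAt riemannXiUpper z = ⊤ := by
      rw [analyticOrderAt_eq_top]
      filter_upwards [hcont.eventually htop'] with w hw
      simpa [riemannXiUpper] using hw
    exact htop this
  obtain ⟨m, hm⟩ := ENat.ne_top_iff_exists.mp hξtop
  have hcomp := analyticOrderAt_comp_affine (f := riemannXi) (a := 1 / 2) (b := I) (z₀ := z)
    I_ne_zero hξan hm.symm
  have hΞ' : analyticOrderAt riemannXiUpper z = m := by
    have : (fun w : ℂ => riemannXi (1 / 2 + I * w)) = riemannXiUpper := by
      funext w; rfl
    rw [← this]; exact hcomp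
  have hnm : n = m := by
    have := hΞ.symm.trans hΞ'
    exact_mod_cast this
  have hζ : analyticOrderAt riemannZeta ρ = n := by
    rw [analyticOrderAt_riemannZeta_eq_riemannXi h0 h1, ← hm, hnm]
  rw [riemannZetaZeroOrder, (analyticOn_riemannZeta ρ hρ1).meromorphicOrderAt_eq, hζ]
  simp

/-- **THE BRIDGE.** `N(T) = zetaZeroCount T`, the tree's Riemann–von Mangoldt counting function
(zeros of `ζ` with `0 < Im ρ ≤ T`, with multiplicity), equals the number of zeros of `Ξ` with
`0 < Re z ≤ T` counted with analytic multiplicity. -/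
theorem sum_analyticOrderNatAt_eq_zetaZeroCount (T : ℝ) :
    ∑ z ∈ (xiZeros_finite T).toFinset, analyticOrderNatAt riemannXiUpper z = zetaZeroCount T := by
  classical
  -- rewrite `N(T)` as a finite sum over the box
  have hfin := zetaZeroBox_finite 0 T
  have hN : (zetaZeroCount T : ℤ) = ∑ ρ ∈ hfin.toFinset, riemannZetaZeroOrder ρ := by
    rw [zetaZeroCount, zetaZeroCountRe, finsum_mem_eq_finite_toFinset_sum _ hfin]
    refine Int.toNat_of_nonneg (Finset.sum_nonneg fun ρ hρ => ?_)
    exact riemannZetaZeroOrder_nonneg_of_mem_zetaZeroBox ((Set.Finite.mem_toFinset _).mp hρ)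
  -- reindex the `Ξ`-side sum along `z ↦ 1/2 + iz`
  have hX : ((∑ z ∈ (xiZeros_finite T).toFinset, analyticOrderNatAt riemannXiUpper z : ℕ) : ℤ)
      = ∑ ρ ∈ hfin.toFinset, riemannZetaZeroOrder ρ := by
    rw [Nat.cast_sum]
    refine Finset.sum_nbij' (fun z => 1 / 2 + I * z) (fun ρ => -I * (ρ - 1 / 2)) ?_ ?_ ?_ ?_ ?_
    · intro z hz
      exact (Set.Finite.mem_toFinset _).mpr
        (half_add_I_mul_mem_zetaZeroBox ((Set.Finite.mem_toFinset _).mp hz))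
    · intro ρ hρ
      obtain ⟨hζ, -, -, him0, himT⟩ := (Set.Finite.mem_toFinset _).mp hρ
      obtain ⟨h0, h1⟩ := re_mem_Ioo_of_riemannZeta_eq_zero_of_im_ne_zero hζ him0.ne'
      refine (Set.Finite.mem_toFinset _).mpr ⟨?_, ?_, ?_⟩
      · have hρ' : (1 / 2 : ℂ) + I * (-I * (ρ - 1 / 2)) = ρ := by
          have : I * I = -1 := Complex.I_mul_I
          linear_combination (-(ρ - 1 / 2)) * this
        rw [riemannXiUpper, hρ']
        exact (riemannXi_eq_zero_iff_holds ρ).mpr ⟨hζ, h0, h1⟩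
      · simpa using him0
      · simpa using himT
    · intro z _
      have : I * I = -1 := Complex.I_mul_I
      linear_combination -z * this
    · intro ρ _
      have : I * I = -1 := Complex.I_mul_I
      linear_combination (-(ρ - 1 / 2)) * this
    · intro z hz
      obtain ⟨hz0, -, -⟩ := (Set.Finite.mem_toFinset _).mp hz
      obtain ⟨-, h0, h1⟩ := zeta_zero_of_riemannXiUpper_eq_zero hz0
      exact analyticOrderNatAt_riemannXiUpper_eq h0 h1
  exact_mod_cast hX.trans hN.symm

end CountThin

end Summit.RiemannHypothesis.RiemannHypothesis.Theorems

end
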